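import Summits.Ventures.PercRepro.GenQPlaneSkew

/-!
# PercRepro — the stays of the plane class (night-4, gen 4; the row (R3) of the type-`5` LP of record)

A plane-type set `S' = Z ⊔ K` (`m(S') = q − 3`; `Z` its cyclic part, of rank `3`, `K` its coloops) loses a point `z ∈ Z`
to the plane-type set `S' ∖ z` exactly when `Z ∖ z` is still cyclic — a STAY of the profile LP
(`mv M G q k (q−3) (q−3)`: the pairs `(S' ∖ z, z)`).  With lines `≤ 3` points:

* `coloopsOf_erase_eq_empty`: `Z ∖ z` is cyclic of rank `3` when `|Z| ≥ 6`, or `|Z| = 5` and every collinear triple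
  of `Z` contains `z`;
* `exists_mem_all_collinear`: a `5`-point rank-`3` set has a point on all of its collinear triples (at most two, sharing
  a point);
* `down`, `mv_eq_down`: the moves counted from the level-`k` side;
* `card_Pc_le_mv_stay` (nullity `2`: `#Pc k (q−3) ≤ mv k (q−3) (q−3)`) and
  `six_mul_card_Pc_le_mv_stay` (nullity `3`: `6·#Pc k (q−3) ≤ mv k (q−3) (q−3)`) — the rows (R3).

Imports `GenQPlaneSkew`.
-/
namespace PercRepro.Night4

open Finset ThmH SixFour GenQ PerFlat Star

variable {α : Type*} [DecidableEq α] {M : Matroid α} [M.Finite]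

/-! ## The cyclic part stays cyclic -/

omit [DecidableEq α] in
/-- A set of `≥ 4` points with lines `≤ 3` has rank `≥ 3`. -/
theorem three_le_eRk_of_four_le (hs : Simple M) (hline : ∀ L ∈ flatsQ M 2, L.card ≤ 3) {X : Finset α}
    (hX : X ⊆ gr M) (h4 : 4 ≤ X.card) : ((3 : ℕ) : ℕ∞) ≤ M.eRk (X : Set α) := by
  by_contra h
  have hle : M.eRk (X : Set α) ≤ 2 := by
    obtain ⟨r, hr⟩ := exists_eRk_eq_nat (M := M) X
    rw [hr] at h ⊢
    have : ¬ 3 ≤ r := fun hle => h (by exact_mod_cast hle)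
    exact_mod_cast (show r ≤ 2 by omega)
  have := card_le_three_of_eRk_le_two' hs hline hX hle
  omega

/-- **`Z ∖ z` is cyclic of rank `3`** when `Z` has rank `3`, `≥ 5` points, lines `≤ 3`, and every collinear triple of `Z`
contains `z` (vacuous when `|Z| ≥ 6`). -/
theorem coloopsOf_erase_eq_empty (hs : Simple M) (hline : ∀ L ∈ flatsQ M 2, L.card ≤ 3) {Z : Finset α}
    (hZ : Z ⊆ gr M) (hr : M.eRk (Z : Set α) = ((3 : ℕ) : ℕ∞)) (h5 : 5 ≤ Z.card) {z : α} (hz : z ∈ Z)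
    (hstay : 6 ≤ Z.card ∨ ∀ T ∈ Z.powersetCard 3, M.eRk (T : Set α) ≤ 2 → z ∈ T) :
    coloopsOf M (Z.erase z) = ∅ ∧ M.eRk ((Z.erase z : Finset α) : Set α) = ((3 : ℕ) : ℕ∞) := by
  have hZz : Z.erase z ⊆ gr M := (Finset.erase_subset _ _).trans hZ
  have hc : (Z.erase z).card = Z.card - 1 := Finset.card_erase_of_mem hz
  have hr1 : M.eRk ((Z.erase z : Finset α) : Set α) = ((3 : ℕ) : ℕ∞) := by
    apply le_antisymm
    · rw [← hr]; exact M.eRk_mono (Finset.coe_subset.2 (Finset.erase_subset _ _))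
    · exact three_le_eRk_of_four_le hs hline hZz (by omega)
  refine ⟨?_, hr1⟩
  rw [Finset.eq_empty_iff_forall_notMem]
  intro y hy
  have hy' := mem_coloopsOf.1 hy
  have hyz := Finset.mem_erase.1 hy'.1
  apply hy'.2
  -- `(Z ∖ z) ∖ y` has rank `3`: it has `≥ 3` points and, at `3` points, is not a collinear triple (it avoids `z`)
  have hW : ((Z.erase z).erase y) ⊆ gr M := (Finset.erase_subset _ _).trans hZz
  have hWc : ((Z.erase z).erase y).card = Z.card - 2 := by
    rw [Finset.card_erase_of_mem hy'.1, hc]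
    omega
  have hWr : M.eRk (((Z.erase z).erase y : Finset α) : Set α) = ((3 : ℕ) : ℕ∞) := by
    apply le_antisymm
    · rw [← hr1]; exact M.eRk_mono (Finset.coe_subset.2 (Finset.erase_subset _ _))
    · by_cases h6 : 6 ≤ Z.card
      · exact three_le_eRk_of_four_le hs hline hW (by omega)
      · -- `|Z| = 5`: the three remaining points are not collinear
        have hc3 : ((Z.erase z).erase y).card = 3 := by omega
        by_contra h
        have hle : M.eRk (((Z.erase z).erase y : Finset α) : Set α) ≤ 2 := by
          obtain ⟨r, hr'⟩ := exists_eRk_eq_nat (M := M) ((Z.erase z).erase y)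
          rw [hr'] at h ⊢
          have : ¬ 3 ≤ r := fun hle => h (by exact_mod_cast hle)
          exact_mod_cast (show r ≤ 2 by omega)
        have hT : (Z.erase z).erase y ∈ Z.powersetCard 3 :=
          Finset.mem_powersetCard.2 ⟨(Finset.erase_subset _ _).trans (Finset.erase_subset _ _), hc3⟩
        have := (hstay.resolve_left h6) _ hT hle
        exact (Finset.mem_erase.1 (Finset.mem_erase.1 this).2).1 rfl
  -- `rk((Z ∖ z) ∖ y) = rk(Z ∖ z)` puts `y` in the closure
  have hcl : M.closure (((Z.erase z).erase y : Finset α) : Set α) = M.closure ((Z.erase z : Finset α) : Set α) :=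
    (M.isRkFinite_of_finite (Finset.finite_toSet _)).closure_eq_closure_of_subset_of_eRk_ge_eRk
      (Finset.coe_subset.2 (Finset.erase_subset _ _)) (by rw [hWr, hr1])
  rw [hcl]
  have hyE : y ∈ M.E := by
    rw [← coe_gr M]
    exact Finset.mem_coe.2 (hZz hy'.1)
  exact M.mem_closure_of_mem' (Finset.mem_coe.2 hy'.1) hyE

/-- **A `5`-point rank-`3` set has a point lying on all of its collinear triples** (lines `≤ 3`): the collinear
triples pairwise share exactly one point, there are at most two of them, and they share a point. -/
theorem exists_mem_all_collinear (hs : Simple M) (hline : ∀ L ∈ flatsQ M 2, L.card ≤ 3) {Z : Finset α}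
    (hZ : Z ⊆ gr M) (h5 : Z.card = 5) :
    ∃ z ∈ Z, ∀ T ∈ Z.powersetCard 3, M.eRk (T : Set α) ≤ 2 → z ∈ T := by
  set 𝒯 := (Z.powersetCard 3).filter (fun T : Finset α => M.eRk (T : Set α) ≤ 2) with h𝒯
  have hmem : ∀ T, T ∈ 𝒯 ↔ T ∈ Z.powersetCard 3 ∧ M.eRk (T : Set α) ≤ 2 := fun T => Finset.mem_filter
  -- two distinct collinear triples of a `5`-set share exactly one point
  have hshare : ∀ T ∈ 𝒯, ∀ T' ∈ 𝒯, T ≠ T' → ∃ c, T ∩ T' = {c} := by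
    intro T hT T' hT' hne
    have hT1 := (hmem T).1 hT
    have hT'1 := (hmem T').1 hT'
    -- they meet: `|T ∪ T'| ≤ 5 < 6`
    have hmeet : (T ∩ T').Nonempty := by
      by_contra hemp
      rw [Finset.not_nonempty_iff_eq_empty] at hemp
      have h1 : (T ∪ T').card = 6 := by
        rw [Finset.card_union_of_disjoint (Finset.disjoint_iff_inter_eq_empty.2 hemp),
          (Finset.mem_powersetCard.1 hT1.1).2, (Finset.mem_powersetCard.1 hT'1.1).2]
      have h2 : T ∪ T' ⊆ Z := Finset.union_subset (Finset.mem_powersetCard.1 hT1.1).1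
        (Finset.mem_powersetCard.1 hT'1.1).1
      have := Finset.card_le_card h2
      omega
    obtain ⟨c, hc⟩ := hmeet
    have hcT := (Finset.mem_inter.1 hc).1
    have hcT' := (Finset.mem_inter.1 hc).2
    refine ⟨c, ?_⟩
    have hdisj := collinear_triples_through_disjoint hs hline hZ hT1.1 hT'1.1 hT1.2 hT'1.2 hcT hcT' hne
    ext x
    rw [Finset.mem_inter, Finset.mem_singleton]
    constructor
    · rintro ⟨hxT, hxT'⟩
      by_contra hxc
      exact Finset.disjoint_left.1 hdisj (Finset.mem_erase.2 ⟨hxc, hxT⟩) (Finset.mem_erase.2 ⟨hxc, hxT'⟩)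
    · rintro rfl; exact ⟨hcT, hcT'⟩
  -- at most two collinear triples
  have hcard : 𝒯.card ≤ 2 := by
    by_contra h
    have h3 : 2 < 𝒯.card := by omega
    obtain ⟨T₁, hT₁, T₂, hT₂, T₃, hT₃, hne, h13, h23⟩ := Finset.two_lt_card.1 h3
    -- `T₁ ∪ T₂ = Z` (5 points, sharing one), and `T₃ ⊆ T₁ ∪ T₂` meets each in `≤ 1` point: `|T₃| ≤ 2`
    obtain ⟨c, hc⟩ := hshare T₁ hT₁ T₂ hT₂ hne
    have hT1 := (hmem T₁).1 hT₁
    have hT2 := (hmem T₂).1 hT₂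
    have hT3 := (hmem T₃).1 hT₃
    have hu : (T₁ ∪ T₂).card = 5 := by
      have := Finset.card_union_add_card_inter T₁ T₂
      rw [hc, Finset.card_singleton, (Finset.mem_powersetCard.1 hT1.1).2, (Finset.mem_powersetCard.1 hT2.1).2] at this
      omega
    have hTZ : T₁ ∪ T₂ = Z := Finset.eq_of_subset_of_card_le
      (Finset.union_subset (Finset.mem_powersetCard.1 hT1.1).1 (Finset.mem_powersetCard.1 hT2.1).1) (by omega)
    obtain ⟨c₁, hc₁⟩ := hshare T₃ hT₃ T₁ hT₁ (Ne.symm h13)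
    obtain ⟨c₂, hc₂⟩ := hshare T₃ hT₃ T₂ hT₂ (Ne.symm h23)
    have hT3sub : T₃ ⊆ (T₃ ∩ T₁) ∪ (T₃ ∩ T₂) := by
      intro x hx
      have hxZ : x ∈ T₁ ∪ T₂ := hTZ ▸ (Finset.mem_powersetCard.1 hT3.1).1 hx
      rw [Finset.mem_union] at hxZ ⊢
      rw [Finset.mem_inter, Finset.mem_inter]
      rcases hxZ with h | h
      · exact Or.inl ⟨hx, h⟩
      · exact Or.inr ⟨hx, h⟩
    have := Finset.card_le_card hT3sub
    rw [hc₁, hc₂, (Finset.mem_powersetCard.1 hT3.1).2] at this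
    have := this.trans (Finset.card_union_le _ _)
    simp at this
  -- choose `z`
  rcases Nat.lt_or_ge 𝒯.card 1 with h0 | h1
  · -- no collinear triple: any point
    obtain ⟨z, hz⟩ := Finset.card_pos.1 (show 0 < Z.card by omega)
    refine ⟨z, hz, fun T hT hr => ?_⟩
    have : T ∈ 𝒯 := (hmem T).2 ⟨hT, hr⟩
    have : 0 < 𝒯.card := Finset.card_pos.2 ⟨T, this⟩
    omega
  · obtain ⟨T₁, hT₁⟩ := Finset.card_pos.1 h1
    rcases Nat.lt_or_ge 𝒯.card 2 with h1' | h2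
    · -- exactly one: `𝒯 = {T₁}`, any point of `T₁`
      have hT1 := (hmem T₁).1 hT₁
      obtain ⟨z, hz⟩ := Finset.card_pos.1 (show 0 < T₁.card by rw [(Finset.mem_powersetCard.1 hT1.1).2]; norm_num)
      refine ⟨z, (Finset.mem_powersetCard.1 hT1.1).1 hz, fun T hT hr => ?_⟩
      have hT' : T ∈ 𝒯 := (hmem T).2 ⟨hT, hr⟩
      have : T = T₁ := by
        by_contra hne
        have : 2 ≤ 𝒯.card := Finset.one_lt_card.2 ⟨T, hT', T₁, hT₁, hne⟩
        omega
      rw [this]; exact hz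
    · -- exactly two: their common point
      have hc2 : 𝒯.card = 2 := by omega
      obtain ⟨T₂, hT₂, hne⟩ : ∃ T₂ ∈ 𝒯, T₁ ≠ T₂ := by
        have := Finset.one_lt_card.1 (show 1 < 𝒯.card by omega)
        obtain ⟨a, ha, b, hb, hab⟩ := this
        by_cases h : T₁ = a
        · exact ⟨b, hb, h ▸ hab⟩
        · exact ⟨a, ha, h⟩
      obtain ⟨c, hc⟩ := hshare T₁ hT₁ T₂ hT₂ hne
      have hcT₁ : c ∈ T₁ := (Finset.mem_inter.1 (hc ▸ Finset.mem_singleton_self c)).1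
      have hcT₂ : c ∈ T₂ := (Finset.mem_inter.1 (hc ▸ Finset.mem_singleton_self c)).2
      have hT1 := (hmem T₁).1 hT₁
      refine ⟨c, (Finset.mem_powersetCard.1 hT1.1).1 hcT₁, fun T hT hr => ?_⟩
      have hT' : T ∈ 𝒯 := (hmem T).2 ⟨hT, hr⟩
      -- `T ∈ {T₁, T₂}`
      have h12 : 𝒯 = {T₁, T₂} := by
        symm
        apply Finset.eq_of_subset_of_card_le
        · intro x hx
          rw [Finset.mem_insert, Finset.mem_singleton] at hx
          rcases hx with rfl | rfl
          · exact hT₁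
          · exact hT₂
        · rw [Finset.card_pair hne, hc2]
      rw [h12, Finset.mem_insert, Finset.mem_singleton] at hT'
      rcases hT' with rfl | rfl
      · exact hcT₁
      · exact hcT₂

/-! ## The moves from the level-`k` side -/

/-- The down-moves of the class `(k, m)` into the class `(k+1, m′)`: `Σ_{S′ ∈ Pc k m} #{z ∈ Z(S′) : m(S′ ∖ z) = m′}`. -/
noncomputable def down (M : Matroid α) [M.Finite] (G : Finset α) (q k m' m : ℕ) : ℕ :=
  ∑ S' ∈ Pc M G q k m, ((S' \ coloopsOf M S').filter (fun z => mTr M (S'.erase z) = m')).card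

/-- **`mv = down`**: the pairs `(S, x)` (`S` at level `k+1`, `m(S) = m′`, `m(S ∪ x) = m`) and the pairs `(S′, z)` (`S′` at
level `k`, `m(S′) = m`, `z` a non-coloop of `S′` with `m(S′ ∖ z) = m′`) correspond by `(S, x) ↦ (S ∪ x, x)`. -/
theorem mv_eq_down {G : Finset α} {q : ℕ} (hG : G ⊆ gr M) (hrG : M.eRk (G : Set α) = (q : ℕ∞)) (k m' m : ℕ) :
    mv M G q k m' m = down M G q k m' m := by
  unfold mv down
  rw [← Finset.card_sigma, ← Finset.card_sigma]
  refine Finset.card_bij' (fun p _ => ⟨insert p.2 p.1, p.2⟩) (fun p _ => ⟨p.1.erase p.2, p.2⟩) ?_ ?_ ?_ ?_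
  · rintro ⟨S, x⟩ hp
    rw [Finset.mem_sigma, Finset.mem_filter, Finset.mem_sdiff] at hp
    obtain ⟨hS, ⟨hxG, hxS⟩, hm⟩ := hp
    have hS' := mem_Pc.1 hS
    have hins : insert x S ∈ Rq M G q := insert_mem_Rq hrG hS'.1 hxG
    rw [Finset.mem_sigma, Finset.mem_filter, Finset.mem_sdiff]
    refine ⟨mem_Pc.2 ⟨hins, ?_, hm⟩, ⟨Finset.mem_insert_self _ _, ?_⟩, ?_⟩
    · rw [Finset.sdiff_insert, Finset.card_erase_of_mem (Finset.mem_sdiff.2 ⟨hxG, hxS⟩), hS'.2.1]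
      rfl
    · -- `x` is not a coloop of `S ∪ x`: `S = (S ∪ x) ∖ x` spans
      intro hx
      have hx' := mem_coloopsOf.1 hx
      apply hx'.2
      rw [Finset.erase_insert hxS]
      apply mem_closure_of_eRk_insert_le' (hG hxG)
      rw [(mem_Rq.1 hins).2, (mem_Rq.1 hS'.1).2]
    · rw [Finset.erase_insert hxS]
      exact hS'.2.2
  · rintro ⟨S', z⟩ hp
    rw [Finset.mem_sigma, Finset.mem_filter, Finset.mem_sdiff] at hp
    obtain ⟨hS', ⟨hzS, hzK⟩, hm'⟩ := hp
    have hS'' := mem_Pc.1 hS'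
    have hS'G := (mem_Rq.1 hS''.1).1
    -- `S′ ∖ z` spans: `z ∈ cl(S′ ∖ z)` as `z` is not a coloop
    have hzcl : z ∈ M.closure ((S'.erase z : Finset α) : Set α) := by
      by_contra h
      exact hzK (mem_coloopsOf.2 ⟨hzS, h⟩)
    have hsp : S'.erase z ∈ Rq M G q := by
      refine mem_Rq.2 ⟨(Finset.erase_subset _ _).trans hS'G, ?_⟩
      rw [← (mem_Rq.1 hS''.1).2]
      have := Star.eRk_insert_eq_of_mem_closure' hzcl
      rw [Finset.insert_erase hzS] at this
      exact this.symm
    rw [Finset.mem_sigma, Finset.mem_filter, Finset.mem_sdiff]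
    refine ⟨mem_Pc.2 ⟨hsp, ?_, hm'⟩, ⟨hS'G hzS, Finset.notMem_erase z S'⟩, ?_⟩
    · rw [Finset.sdiff_erase (hS'G hzS), Finset.card_insert_of_notMem (fun h => (Finset.mem_sdiff.1 h).2 hzS),
        hS''.2.1]
    · rw [Finset.insert_erase hzS]
      exact hS''.2.2
  · rintro ⟨S, x⟩ hp
    rw [Finset.mem_sigma, Finset.mem_filter, Finset.mem_sdiff] at hp
    simp only
    rw [Finset.erase_insert hp.2.1.2]
  · rintro ⟨S', z⟩ hp
    rw [Finset.mem_sigma, Finset.mem_filter, Finset.mem_sdiff] at hp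
    simp only
    rw [Finset.insert_erase hp.2.1.1]

/-- The cyclic part of `S′ ∈ Pc k (q − 3)` has rank `3` and `d − k + 3` points. -/
theorem cyclic_part_of_plane_type {G S' : Finset α} {q d k : ℕ} (hG : G ⊆ gr M) (hq : 3 ≤ q)
    (hcard : G.card = q + d) (hS' : S' ∈ Pc M G q k (q - 3)) :
    M.eRk ((S' \ coloopsOf M S' : Finset α) : Set α) = ((3 : ℕ) : ℕ∞) ∧
      (S' \ coloopsOf M S').card = d - k + 3 := by
  have hS := mem_Pc.1 hS'
  have hSG := (mem_Rq.1 hS.1).1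
  have hr := eRk_sdiff_coloopsOf_add_mTr hG hS.1
  rw [hS.2.2] at hr
  constructor
  · obtain ⟨a, ha⟩ := exists_eRk_eq_nat (M := M) (S' \ coloopsOf M S')
    rw [ha] at hr ⊢
    have h' : a + (q - 3) = q := by exact_mod_cast hr
    have : a = 3 := by omega
    rw [this]
  · rw [card_sdiff_coloopsOf, hS.2.2]
    have h1 : (G \ S').card + S'.card = G.card := by
      rw [Finset.card_sdiff_of_subset hSG]
      exact Nat.sub_add_cancel (Finset.card_le_card hSG)
    have h2 : q ≤ S'.card := le_card_of_eRk_eq (mem_Rq.1 hS.1).2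
    rw [hS.2.1, hcard] at h1
    omega

/-- **(R3) at nullity `2`**: every plane-type set with a `5`-point cyclic part has a stay: `#Pc k (q−3) ≤ mv k (q−3) (q−3)`
(`d − k = 2`, lines `≤ 3`). -/
theorem card_Pc_le_mv_stay (hs : Simple M) (hline : ∀ L ∈ flatsQ M 2, L.card ≤ 3) {G : Finset α} {q d k : ℕ}
    (hG : G ⊆ gr M) (hrG : M.eRk (G : Set α) = (q : ℕ∞)) (hq : 3 ≤ q) (hcard : G.card = q + d)
    (hk : d = k + 2) : (Pc M G q k (q - 3)).card ≤ mv M G q k (q - 3) (q - 3) := by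
  rw [mv_eq_down hG hrG]
  unfold down
  rw [Finset.card_eq_sum_ones]
  apply Finset.sum_le_sum
  intro S' hS'
  obtain ⟨hZr, hZc⟩ := cyclic_part_of_plane_type hG hq hcard hS'
  have hS := mem_Pc.1 hS'
  have hZg : S' \ coloopsOf M S' ⊆ gr M := Finset.sdiff_subset.trans ((mem_Rq.1 hS.1).1.trans hG)
  have h5 : (S' \ coloopsOf M S').card = 5 := by rw [hZc]; omega
  obtain ⟨z, hz, hstay⟩ := exists_mem_all_collinear hs hline hZg h5
  obtain ⟨hcol, -⟩ := coloopsOf_erase_eq_empty hs hline hZg hZr (by omega) hz (Or.inr hstay)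
  rw [Finset.one_le_card]
  refine ⟨z, Finset.mem_filter.2 ⟨hz, ?_⟩⟩
  rw [mTr_erase_eq hG hS.1 hz, hS.2.2]
  unfold mTr
  rw [hcol, Finset.card_empty, add_zero]

/-- **(R3) at nullity `3`**: every deletion from a `6`-point plane is a stay: `6·#Pc k (q−3) ≤ mv k (q−3) (q−3)`
(`d − k = 3`, lines `≤ 3`). -/
theorem six_mul_card_Pc_le_mv_stay (hs : Simple M) (hline : ∀ L ∈ flatsQ M 2, L.card ≤ 3) {G : Finset α}
    {q d k : ℕ} (hG : G ⊆ gr M) (hrG : M.eRk (G : Set α) = (q : ℕ∞)) (hq : 3 ≤ q) (hcard : G.card = q + d)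
    (hk : d = k + 3) : 6 * (Pc M G q k (q - 3)).card ≤ mv M G q k (q - 3) (q - 3) := by
  rw [mv_eq_down hG hrG]
  unfold down
  rw [Finset.card_eq_sum_ones, Finset.mul_sum]
  apply Finset.sum_le_sum
  intro S' hS'
  obtain ⟨hZr, hZc⟩ := cyclic_part_of_plane_type hG hq hcard hS'
  have hS := mem_Pc.1 hS'
  have hZg : S' \ coloopsOf M S' ⊆ gr M := Finset.sdiff_subset.trans ((mem_Rq.1 hS.1).1.trans hG)
  have h6 : (S' \ coloopsOf M S').card = 6 := by rw [hZc]; omega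
  rw [mul_one]
  -- every `z ∈ Z` is a stay
  have hall : (S' \ coloopsOf M S').filter (fun z => mTr M (S'.erase z) = q - 3) = S' \ coloopsOf M S' := by
    apply Finset.filter_true_of_mem
    intro z hz
    obtain ⟨hcol, -⟩ := coloopsOf_erase_eq_empty hs hline hZg hZr (by omega) hz (Or.inl (by omega))
    rw [mTr_erase_eq hG hS.1 hz, hS.2.2]
    unfold mTr
    rw [hcol, Finset.card_empty, add_zero]
  rw [hall, h6]

end PercRepro.Night4
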